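import Summits.ABC.ABC.Theorems.IneffectiveSubspaceUniformSadicTowerFourFlatSteepSplit
import Summits.ABC.ABC.Theorems.IneffectiveSubspaceUniformSadicTowerFourHeavyPlacesReductions
import Summits.ABC.ABC.Theorems.IneffectiveSubspaceUniformSadicTowerFourFlatSteepSplitCore
import Summits.ABC.ABC.Theorems.IneffectiveSubspaceUniformSadicTowerFourChildrenOfAbc
import Summits.ABC.ABC.Theorems.IneffectiveSubspaceDeepRegimeABCOmegaTail
import Summits.ABC.ABC.Theorems.IneffectiveSubspaceAbcGivesUniformSadic

/-!
# `UniformSadicTowerFour` (stmt-ABC-14937): the HEAVY child alone gives abc on every bounded-`ω` cell —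
# the FLAT child is absorbed by the route's crux #6 (line `flat-steep-split`, lead c2)

Crux (route `IneffectiveSubspace`, rank 2) in the landed split form (`FlatSteepSplitCore`, p138240):
`UniformSadicTowerFour ⟺ FLAT-QUARTER ∧ HEAVY-CORE`, where

* FLAT-QUARTER: abc with the 4-rounded radical `rad₄` for triples all of whose blocks are `< c^{1/4}`;
* HEAVY-CORE: `∀ θ ∈ (0,1] ∀ ε > 0 ∃ C ∀ S ≠ ∅ primes ∀ abc triples with every p ∈ S θ-heavy
  (c^θ ≤ p^{v_p(abc)}): c < C · M_S(abc)^(1+ε)`, `M_S(N) = (∏_{p∈S} p) · ∏_{p ∣ N, p ∉ S} p^⌈v_p(N)/4⌉`.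

This file proves, sorry-free:

* `exists_heavy_block`: an abc triple with `ω(abc) ≤ W` has a θ-heavy prime as soon as `θ·W ≤ 1/2`
  (the `≤ W` blocks multiply to `abc ≥ c`, so the largest is `≥ c^{1/W}`);
* `boundedOmega_of_heavyCore` (**the point**): HEAVY-CORE ⟹ abc on every bounded-`ω` cell
  `{ω(abc) ≤ W}` with a constant `C(W, ε)` ("BoundedOmegaABC", the S-unit/Pillai corner with moving primes):
  given `W, ε₀` take `θ = min(ε₀/((W+1)(1+ε₀)(2+ε₀)), 1/4)` and `S := H`, the set of θ-heavy primes of the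
  triple (non-empty by `exists_heavy_block`); HEAVY-CORE at `H` gives `c < C·M_H^(1+ε₀/2)`, and
  `M_H ≤ rad(abc) · c^{θW}` because the discounted primes are charged `p`, and each of the `≤ W` light primes
  is charged `p^⌈v/4⌉ ≤ p^{v} < c^θ` (`FlatSteepSplit.rounded_le_full`, `light_prod_le`); the factor `c^{θW}` is
  absorbed by `FlatSteepSplit.real_step`, giving `c < C² · rad(abc)^(1+ε₀)`;
* `abc_of_heavyCore_of_deepRegimeABC`: HEAVY-CORE ∧ `DeepRegimeABC` (crux #6 of the SAME route, stmt-ABC-15121)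
  ⟹ `ABC`, by the landed complement theorem `DeepRegimeABC.abc_of_deepRegimeABC_of_boundedOmega`
  (`ABC ⟺ DeepRegimeABC ∧ BoundedOmegaABC`);
* hence `uniformSadicTowerFour_of_heavyCore_of_deepRegimeABC` (through `abcGivesUniformSadic_proof`),
  `flatQuarter_of_heavyCore_of_deepRegimeABC` (the FLAT child is implied by the HEAVY child and crux #6),
  `uniformSadicTowerFour_iff_heavyCore_of_deepRegimeABC` (modulo #6 the crux IS its heavy child) and
  `abc_iff_heavyCore_and_deepRegimeABC`;
* `heavyBounded_iff_boundedOmega`: restricted to bounded-`ω` cells, HEAVY-CORE is EXACTLY BoundedOmegaABC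
  (the mixed radical dominates `rad`, `MixedRadical.uniformInK_rad_le_mixed`).

Reading for the route (`closes : #2 → #3 → #4 → #6 → ABC`, load-bearing binders #2 and #6): the binder #2
can be weakened to its HEAVY child (c1's `HeavyPlacesFour`, `Cruxes/UniformSadicTowerFour/Lines/flat-steep-split-children.md`)
with glue `abc_of_heavyCore_of_deepRegimeABC`; the FLAT child (abc with `rad₄` on `c^{1/4}`-powersmooth triples) is
surplus to the assembly.  No new definitions.  Deliberately NOT here: HEAVY-CORE itself (open, abc-type; registered
stub `stub_heavyCore` of the line) and `DeepRegimeABC` (open, item stmt-ABC-15121).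
-/

noncomputable section

-- `Summit.<Summit>.<Problem>` is the mandated summit-side namespace (CONVENTIONS §2); for the
-- single-conjunct summit `ABC` the two coincide, so the duplicate `ABC.ABC` is deliberate.
set_option linter.dupNamespace false

namespace Summit.ABC.ABC.Theorems.UniformSadicTowerFour.HeavyPlaces

open Literature.NumberTheory.DiophantineGeometry (IsABCTriple rad rad_def)
open Summit.ABC.ABC.Theses.IneffectiveSubspace
open Summit.ABC.ABC.Theorems.UniformSadicTowerFour.FlatSteepSplit
  (rounded_le_full light_prod_le real_step flatQuarter_of_abc heavyCore_of_abc
    uniformSadicTowerFour_iff_quarter_and_core)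
open Summit.ABC.ABC.Theorems.UniformSadicTowerFour.MixedRadical (uniformInK_rad_le_mixed)
open Summit.ABC.ABC.Theorems.DeepRegimeABC (abc_of_deepRegimeABC_of_boundedOmega deepRegimeABC_of_abc)
open scoped BigOperators

/-! ## A bounded-`ω` triple has a dominant block -/

/-- **Existence of a heavy prime on bounded-`ω` cells.** If `ω(abc) ≤ W` and `θ·W ≤ 1/2` (`θ ≥ 0`), then some
prime `p ∣ abc` is θ-heavy, `c^θ ≤ p^{v_p(abc)}`: otherwise `abc = ∏ p^{v_p} < (c^θ)^W ≤ c^{1/2} < c ≤ abc`.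
[folklore] -/
theorem exists_heavy_block {a b c : ℕ} (h : IsABCTriple a b c) {θ : ℝ} (hθ : 0 ≤ θ) {W : ℕ}
    (hθW : θ * W ≤ 1 / 2) (hcard : (a * b * c).primeFactors.card ≤ W) :
    ∃ p ∈ (a * b * c).primeFactors,
      (c : ℝ) ^ θ ≤ ((p ^ (a * b * c).factorization p : ℕ) : ℝ) := by
  obtain ⟨ha, hb, hsum, _⟩ := h
  set N := a * b * c with hNdef
  have hc2 : 2 ≤ c := by omega
  have hc1 : 1 ≤ c := by omega
  have hN0 : N ≠ 0 := by positivity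
  by_contra hall
  push Not at hall
  have hprod : ∏ p ∈ N.primeFactors, p ^ N.factorization p = N :=
    (Nat.prod_primeFactors_pow_factorization hN0).symm
  have h1 : (N : ℝ) ≤ ((c : ℝ) ^ θ) ^ W := by
    have := light_prod_le (N := N) hc1 hθ hcard hall
    rwa [hprod] at this
  have hc0 : (0 : ℝ) ≤ c := by positivity
  have hc1R : (1 : ℝ) < c := by exact_mod_cast hc2
  have h2 : ((c : ℝ) ^ θ) ^ W ≤ (c : ℝ) ^ (1 / 2 : ℝ) := by
    rw [← Real.rpow_natCast, ← Real.rpow_mul hc0]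
    exact Real.rpow_le_rpow_of_exponent_le hc1R.le hθW
  have h3 : (c : ℝ) ^ (1 / 2 : ℝ) < c := by
    conv_rhs => rw [← Real.rpow_one (c : ℝ)]
    exact Real.rpow_lt_rpow_of_exponent_lt hc1R (by norm_num)
  have h4 : (c : ℝ) ≤ N := by
    exact_mod_cast (Nat.le_mul_of_pos_left c (Nat.mul_pos ha hb) : c ≤ a * b * c)
  linarith

/-! ## HEAVY-CORE gives abc on bounded-`ω` cells -/

/-- **The heavy statement on a bounded-`ω` cell gives abc on that cell.** If for every `W`, `θ ∈ (0,1]`,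
`ε > 0` there is `C` with `c < C · M_S(abc)^(1+ε)` for every non-empty set `S` of θ-heavy primes of every abc
triple with `ω(abc) ≤ W`, then abc holds on every cell `{ω(abc) ≤ W}` with a constant `C(W, ε)`: take
`θ = θ(W, ε)` small and `S :=` the θ-heavy primes of the triple (non-empty by `exists_heavy_block`); the at most
`W` light rounded charges exceed the radical by `< c^{θW}`, absorbed by `FlatSteepSplit.real_step`. [folklore] -/
theorem boundedOmega_of_heavyBounded
    (h : ∀ W : ℕ, ∀ θ : ℝ, 0 < θ → θ ≤ 1 → ∀ ε : ℝ, 0 < ε → ∃ C : ℝ, 0 < C ∧ ∀ S : Finset ℕ,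
      S.Nonempty → (∀ p ∈ S, Nat.Prime p) → ∀ a b c : ℕ, IsABCTriple a b c →
      (a * b * c).primeFactors.card ≤ W →
      (∀ p ∈ S, (c : ℝ) ^ θ ≤ ((p ^ (a * b * c).factorization p : ℕ) : ℝ)) →
      (c : ℝ) < C * ((((∏ p ∈ S, p) *
        ∏ p ∈ (a * b * c).primeFactors \ S, p ^ (((a * b * c).factorization p + 3) / 4) : ℕ) : ℝ)) ^
          (1 + ε)) :
    ∀ W : ℕ, ∀ ε : ℝ, 0 < ε → ∃ C : ℝ, 0 < C ∧ ∀ a b c : ℕ, IsABCTriple a b c →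
      (a * b * c).primeFactors.card ≤ W →
      (c : ℝ) < C * ((rad a b c : ℕ) : ℝ) ^ (1 + ε) := by
  classical
  intro W ε₀ hε₀
  -- parameters (as in `FlatSteepSplit.uniformSadicTowerFour_of_flat_of_heavy`, budget `K` ↦ `W`)
  set ε₁ : ℝ := ε₀ / 2 with hε₁def
  have hε₁ : 0 < ε₁ := by positivity
  set D : ℝ := ((W : ℝ) + 1) * ((1 + ε₀) * (2 + ε₀)) with hDdef
  have hD : 0 < D := by positivity
  set θ₀ : ℝ := ε₀ / D with hθ₀def
  have hθ₀ : 0 < θ₀ := by positivity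
  have hθ₀D : θ₀ * D = ε₀ := div_mul_cancel₀ ε₀ hD.ne'
  set θ : ℝ := min θ₀ (1 / 4) with hθdef
  have hθ : 0 < θ := lt_min hθ₀ (by norm_num)
  have hθle : θ ≤ θ₀ := min_le_left _ _
  have hθ1 : θ ≤ 1 := (min_le_right _ _).trans (by norm_num)
  -- the key size of θ: θ·W·(1+ε₀)(2+ε₀) ≤ ε₀
  have hθW : θ * W * ((1 + ε₀) * (2 + ε₀)) ≤ ε₀ := by
    have hW1 : (W : ℝ) ≤ W + 1 := by linarith
    calc θ * W * ((1 + ε₀) * (2 + ε₀)) ≤ θ₀ * (W + 1) * ((1 + ε₀) * (2 + ε₀)) := by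
          gcongr
      _ = θ₀ * D := by rw [hDdef]; ring
      _ = ε₀ := hθ₀D
  -- constant
  obtain ⟨C₂, hC₂, hheavy⟩ := h W θ hθ hθ1 ε₁ hε₁
  set C₀ : ℝ := max C₂ 1 with hC₀def
  have hC₀1 : 1 ≤ C₀ := le_max_right _ _
  have hC₂le : C₂ ≤ C₀ := le_max_left _ _
  refine ⟨C₀ ^ (2 : ℝ), by positivity, fun a b c habc hcardW => ?_⟩
  have habc' := habc
  obtain ⟨ha, hb, hsum, hcop⟩ := habc
  set N := a * b * c with hNdef
  have hc1 : 1 ≤ c := by omega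
  have hc1R : (1 : ℝ) ≤ c := by exact_mod_cast hc1
  have hN0 : N ≠ 0 := by positivity
  -- exponent data for `real_step`
  have hs : (0 : ℝ) < 1 + ε₁ := by linarith
  have hd : (0 : ℝ) ≤ θ * W := by positivity
  have hds : θ * W * (1 + ε₁) ≤ 1 / 2 := by
    rw [hε₁def]; nlinarith [hθW, hε₀, hd, mul_nonneg hd hε₀.le]
  have hst : 1 + ε₁ ≤ (1 + ε₀) * (1 - θ * W * (1 + ε₁)) := by
    rw [hε₁def]; nlinarith [hθW, hε₀, hd]
  have hθWhalf : θ * W ≤ 1 / 2 := by nlinarith [hds, mul_nonneg hd hε₁.le]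
  -- the heavy set `H` of the triple
  set H := N.primeFactors.filter (fun q => (c : ℝ) ^ θ ≤ ((q ^ N.factorization q : ℕ) : ℝ))
    with hHdef
  have hHsub : H ⊆ N.primeFactors := Finset.filter_subset _ _
  have hHprime : ∀ p ∈ H, p.Prime := fun p hp => Nat.prime_of_mem_primeFactors (hHsub hp)
  have hHheavy : ∀ p ∈ H, (c : ℝ) ^ θ ≤ ((p ^ N.factorization p : ℕ) : ℝ) := fun p hp =>
    (Finset.mem_filter.mp hp).2
  have hlight : ∀ q ∈ N.primeFactors \ H, ((q ^ N.factorization q : ℕ) : ℝ) < (c : ℝ) ^ θ := by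
    intro q hq
    rw [Finset.mem_sdiff] at hq
    by_contra hle
    exact hq.2 (Finset.mem_filter.mpr ⟨hq.1, not_lt.mp hle⟩)
  have hHne : H.Nonempty := by
    obtain ⟨p, hp, hpH⟩ := exists_heavy_block habc' hθ.le hθWhalf hcardW
    exact ⟨p, Finset.mem_filter.mpr ⟨hp, hpH⟩⟩
  -- HEAVY-CORE at `S := H`
  have key := hheavy H hHne hHprime a b c habc' hcardW hHheavy
  -- `M_H ≤ rad(abc) · c^(θW)`
  have hcθW : ((c : ℝ) ^ θ) ^ W = (c : ℝ) ^ (θ * W) := by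
    rw [← Real.rpow_natCast, ← Real.rpow_mul (by positivity : (0 : ℝ) ≤ c)]
  have hradpos : 0 < rad a b c := by
    rw [rad_def]; exact Nat.pos_of_ne_zero UniqueFactorizationMonoid.radical_ne_zero
  have hM1 : (1 : ℝ) ≤ (rad a b c : ℕ) := by exact_mod_cast hradpos
  have hHrad : ∏ p ∈ H, p ≤ rad a b c := by
    rw [rad_def, Nat.radical_eq_prod_primeFactors]
    exact Nat.le_of_dvd (Finset.prod_pos fun p hp => Nat.pos_of_mem_primeFactors hp)
      (Finset.prod_dvd_prod_of_subset _ _ _ hHsub)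
  have hcardA : (N.primeFactors \ H).card ≤ W :=
    (Finset.card_le_card Finset.sdiff_subset).trans hcardW
  have hXR : ((((∏ p ∈ H, p) * ∏ p ∈ N.primeFactors \ H, p ^ ((N.factorization p + 3) / 4) : ℕ) : ℝ))
      ≤ ((rad a b c : ℕ) : ℝ) * (c : ℝ) ^ (θ * W) := by
    have h1 : (∏ p ∈ H, p) * ∏ p ∈ N.primeFactors \ H, p ^ ((N.factorization p + 3) / 4) ≤
        rad a b c * ∏ p ∈ N.primeFactors \ H, p ^ N.factorization p :=
      Nat.mul_le_mul hHrad (rounded_le_full N Finset.sdiff_subset)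
    have h2 : ((((∏ p ∈ H, p) * ∏ p ∈ N.primeFactors \ H, p ^ ((N.factorization p + 3) / 4) : ℕ) : ℝ))
        ≤ ((rad a b c : ℕ) : ℝ) * ((∏ p ∈ N.primeFactors \ H, p ^ N.factorization p : ℕ) : ℝ) := by
      exact_mod_cast h1
    refine h2.trans (mul_le_mul_of_nonneg_left ?_ (by positivity))
    rw [← hcθW]
    exact light_prod_le hc1 hθ.le hcardA hlight
  have key' : (c : ℝ) < C₀ * ((((∏ p ∈ H, p) *
      ∏ p ∈ N.primeFactors \ H, p ^ ((N.factorization p + 3) / 4) : ℕ) : ℝ)) ^ (1 + ε₁) :=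
    key.trans_le (mul_le_mul_of_nonneg_right hC₂le (by positivity))
  exact real_step hC₀1 hs hds hst hc1R hM1 (Nat.cast_nonneg _) hXR key'

/-- **HEAVY-CORE ⟹ BoundedOmegaABC.** The heavy child of the crux (core form: `θ ∈ (0,1]`, non-empty `S`
of θ-heavy primes, mixed radical `M_S`, no budget on `|S|`) implies abc with a constant `C(W, ε)` on every cell
`{ω(abc) ≤ W}` — the S-unit / Pillai corner with moving primes (`boundedOmega_of_heavyBounded`, the cell
hypothesis being an instance of HEAVY-CORE). [folklore] -/
theorem boundedOmega_of_heavyCore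
    (h : ∀ θ : ℝ, 0 < θ → θ ≤ 1 → ∀ ε : ℝ, 0 < ε → ∃ C : ℝ, 0 < C ∧ ∀ S : Finset ℕ, S.Nonempty →
      (∀ p ∈ S, Nat.Prime p) → ∀ a b c : ℕ, IsABCTriple a b c →
      (∀ p ∈ S, (c : ℝ) ^ θ ≤ ((p ^ (a * b * c).factorization p : ℕ) : ℝ)) →
      (c : ℝ) < C * ((((∏ p ∈ S, p) *
        ∏ p ∈ (a * b * c).primeFactors \ S, p ^ (((a * b * c).factorization p + 3) / 4) : ℕ) : ℝ)) ^
          (1 + ε)) :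
    ∀ W : ℕ, ∀ ε : ℝ, 0 < ε → ∃ C : ℝ, 0 < C ∧ ∀ a b c : ℕ, IsABCTriple a b c →
      (a * b * c).primeFactors.card ≤ W →
      (c : ℝ) < C * ((rad a b c : ℕ) : ℝ) ^ (1 + ε) :=
  boundedOmega_of_heavyBounded fun _W θ hθ hθ1 ε hε => by
    obtain ⟨C, hC, hC'⟩ := h θ hθ hθ1 ε hε
    exact ⟨C, hC, fun S hS hSp a b c habc _ hheavy => hC' S hS hSp a b c habc hheavy⟩

/-! ## Composition with the route's crux #6 -/

/-- **HEAVY-CORE ∧ DeepRegimeABC ⟹ ABC.** The heavy child of crux #2 together with crux #6 of the same route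
(`DeepRegimeABC`, stmt-ABC-15121) gives `ABC`: `boundedOmega_of_heavyCore` feeds the bounded-`ω` corner of the
landed complement theorem `abc_of_deepRegimeABC_of_boundedOmega`. [folklore] -/
theorem abc_of_heavyCore_of_deepRegimeABC
    (hH : ∀ θ : ℝ, 0 < θ → θ ≤ 1 → ∀ ε : ℝ, 0 < ε → ∃ C : ℝ, 0 < C ∧ ∀ S : Finset ℕ, S.Nonempty →
      (∀ p ∈ S, Nat.Prime p) → ∀ a b c : ℕ, IsABCTriple a b c →
      (∀ p ∈ S, (c : ℝ) ^ θ ≤ ((p ^ (a * b * c).factorization p : ℕ) : ℝ)) →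
      (c : ℝ) < C * ((((∏ p ∈ S, p) *
        ∏ p ∈ (a * b * c).primeFactors \ S, p ^ (((a * b * c).factorization p + 3) / 4) : ℕ) : ℝ)) ^
          (1 + ε))
    (h₆ : DeepRegimeABC) : ABC :=
  abc_of_deepRegimeABC_of_boundedOmega h₆ (boundedOmega_of_heavyCore hH)

/-- **HEAVY-CORE ∧ DeepRegimeABC ⟹ `UniformSadicTowerFour`** (through `ABC` and the landed support
`abcGivesUniformSadic_proof`): modulo crux #6, the crux reduces to its heavy child. [folklore] -/
theorem uniformSadicTowerFour_of_heavyCore_of_deepRegimeABC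
    (hH : ∀ θ : ℝ, 0 < θ → θ ≤ 1 → ∀ ε : ℝ, 0 < ε → ∃ C : ℝ, 0 < C ∧ ∀ S : Finset ℕ, S.Nonempty →
      (∀ p ∈ S, Nat.Prime p) → ∀ a b c : ℕ, IsABCTriple a b c →
      (∀ p ∈ S, (c : ℝ) ^ θ ≤ ((p ^ (a * b * c).factorization p : ℕ) : ℝ)) →
      (c : ℝ) < C * ((((∏ p ∈ S, p) *
        ∏ p ∈ (a * b * c).primeFactors \ S, p ^ (((a * b * c).factorization p + 3) / 4) : ℕ) : ℝ)) ^
          (1 + ε))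
    (h₆ : DeepRegimeABC) : UniformSadicTowerFour :=
  (show ABC → UniformSadicTowerFour from abcGivesUniformSadic_proof)
    (abc_of_heavyCore_of_deepRegimeABC hH h₆)

/-- **The FLAT child is absorbed**: FLAT-QUARTER (abc with `rad₄` on `c^{1/4}`-powersmooth triples) follows from
HEAVY-CORE and crux #6 (`ChildrenOfAbc.flatQuarter_of_abc` after `abc_of_heavyCore_of_deepRegimeABC`). [folklore] -/
theorem flatQuarter_of_heavyCore_of_deepRegimeABC
    (hH : ∀ θ : ℝ, 0 < θ → θ ≤ 1 → ∀ ε : ℝ, 0 < ε → ∃ C : ℝ, 0 < C ∧ ∀ S : Finset ℕ, S.Nonempty →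
      (∀ p ∈ S, Nat.Prime p) → ∀ a b c : ℕ, IsABCTriple a b c →
      (∀ p ∈ S, (c : ℝ) ^ θ ≤ ((p ^ (a * b * c).factorization p : ℕ) : ℝ)) →
      (c : ℝ) < C * ((((∏ p ∈ S, p) *
        ∏ p ∈ (a * b * c).primeFactors \ S, p ^ (((a * b * c).factorization p + 3) / 4) : ℕ) : ℝ)) ^
          (1 + ε))
    (h₆ : DeepRegimeABC) :
    ∀ ε : ℝ, 0 < ε → ∃ C : ℝ, 0 < C ∧ ∀ a b c : ℕ, IsABCTriple a b c →
      (∀ p ∈ (a * b * c).primeFactors,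
        ((p ^ (a * b * c).factorization p : ℕ) : ℝ) < (c : ℝ) ^ (1 / 4 : ℝ)) →
      (c : ℝ) < C * ((∏ p ∈ (a * b * c).primeFactors,
        p ^ (((a * b * c).factorization p + 3) / 4) : ℕ) : ℝ) ^ (1 + ε) :=
  flatQuarter_of_abc (abc_of_heavyCore_of_deepRegimeABC hH h₆)

/-- **Modulo crux #6 the crux IS its heavy child**: under `DeepRegimeABC`,
`UniformSadicTowerFour ⟺ HEAVY-CORE`. [folklore] -/
theorem uniformSadicTowerFour_iff_heavyCore_of_deepRegimeABC (h₆ : DeepRegimeABC) :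
    UniformSadicTowerFour ↔
      (∀ θ : ℝ, 0 < θ → θ ≤ 1 → ∀ ε : ℝ, 0 < ε → ∃ C : ℝ, 0 < C ∧ ∀ S : Finset ℕ, S.Nonempty →
        (∀ p ∈ S, Nat.Prime p) → ∀ a b c : ℕ, IsABCTriple a b c →
        (∀ p ∈ S, (c : ℝ) ^ θ ≤ ((p ^ (a * b * c).factorization p : ℕ) : ℝ)) →
        (c : ℝ) < C * ((((∏ p ∈ S, p) *
          ∏ p ∈ (a * b * c).primeFactors \ S, p ^ (((a * b * c).factorization p + 3) / 4) : ℕ) : ℝ)) ^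
            (1 + ε)) :=
  ⟨fun hU => (uniformSadicTowerFour_iff_quarter_and_core.mp hU).2,
    fun hH => uniformSadicTowerFour_of_heavyCore_of_deepRegimeABC hH h₆⟩

/-- **`ABC ⟺ HEAVY-CORE ∧ DeepRegimeABC`**: the route's thesis `X = #2 ∧ #6` may replace #2 by its heavy
child without changing the deciding theorem's strength. [folklore] -/
theorem abc_iff_heavyCore_and_deepRegimeABC :
    ABC ↔
      ((∀ θ : ℝ, 0 < θ → θ ≤ 1 → ∀ ε : ℝ, 0 < ε → ∃ C : ℝ, 0 < C ∧ ∀ S : Finset ℕ, S.Nonempty →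
        (∀ p ∈ S, Nat.Prime p) → ∀ a b c : ℕ, IsABCTriple a b c →
        (∀ p ∈ S, (c : ℝ) ^ θ ≤ ((p ^ (a * b * c).factorization p : ℕ) : ℝ)) →
        (c : ℝ) < C * ((((∏ p ∈ S, p) *
          ∏ p ∈ (a * b * c).primeFactors \ S, p ^ (((a * b * c).factorization p + 3) / 4) : ℕ) : ℝ)) ^
            (1 + ε)) ∧ DeepRegimeABC) :=
  ⟨fun h => ⟨heavyCore_of_abc h, deepRegimeABC_of_abc h⟩,
    fun h => abc_of_heavyCore_of_deepRegimeABC h.1 h.2⟩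

/-! ## On bounded-`ω` cells HEAVY-CORE is exactly BoundedOmegaABC -/

/-- **HEAVY-CORE restricted to bounded-`ω` cells ⟺ BoundedOmegaABC.** The part of the heavy child that the
route consumes — triples with `ω(abc) ≤ W`, constant `C(W, θ, ε)` — is EQUIVALENT to abc on bounded-`ω` cells:
`⟹` is `boundedOmega_of_heavyBounded`; `⟸` because `rad(abc) ≤ M_S(abc)` for every set of primes `S`
(`uniformInK_rad_le_mixed`). [folklore] -/
theorem heavyBounded_iff_boundedOmega :
    (∀ W : ℕ, ∀ θ : ℝ, 0 < θ → θ ≤ 1 → ∀ ε : ℝ, 0 < ε → ∃ C : ℝ, 0 < C ∧ ∀ S : Finset ℕ, S.Nonempty →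
      (∀ p ∈ S, Nat.Prime p) → ∀ a b c : ℕ, IsABCTriple a b c → (a * b * c).primeFactors.card ≤ W →
      (∀ p ∈ S, (c : ℝ) ^ θ ≤ ((p ^ (a * b * c).factorization p : ℕ) : ℝ)) →
      (c : ℝ) < C * ((((∏ p ∈ S, p) *
        ∏ p ∈ (a * b * c).primeFactors \ S, p ^ (((a * b * c).factorization p + 3) / 4) : ℕ) : ℝ)) ^
          (1 + ε)) ↔
    (∀ W : ℕ, ∀ ε : ℝ, 0 < ε → ∃ C : ℝ, 0 < C ∧ ∀ a b c : ℕ, IsABCTriple a b c →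
      (a * b * c).primeFactors.card ≤ W →
      (c : ℝ) < C * ((rad a b c : ℕ) : ℝ) ^ (1 + ε)) := by
  refine ⟨boundedOmega_of_heavyBounded, fun h W θ _ _ ε hε => ?_⟩
  obtain ⟨C, hC, hC'⟩ := h W ε hε
  refine ⟨C, hC, fun S _ hS a b c habc hcard _ => ?_⟩
  have hrad : ((rad a b c : ℕ) : ℝ) ≤
      (((∏ p ∈ S, p) *
        ∏ p ∈ (a * b * c).primeFactors \ S, p ^ (((a * b * c).factorization p + 3) / 4) : ℕ) : ℝ) := by
    exact_mod_cast uniformInK_rad_le_mixed a b c S hS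
  calc (c : ℝ) < C * ((rad a b c : ℕ) : ℝ) ^ (1 + ε) := hC' a b c habc hcard
    _ ≤ C * ((((∏ p ∈ S, p) *
        ∏ p ∈ (a * b * c).primeFactors \ S, p ^ (((a * b * c).factorization p + 3) / 4) : ℕ) : ℝ)) ^
          (1 + ε) := by
      gcongr

end Summit.ABC.ABC.Theorems.UniformSadicTowerFour.HeavyPlaces

end
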